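import Mathlib.GroupTheory.Commutator.Basic
import Summits.MatrixMultiplication.OmegaCensus.BoxBadDerivedTwo
import Summits.MatrixMultiplication.OmegaCensus.BoxBadDerivedFour
import Summits.MatrixMultiplication.OmegaCensus.BoxBadOrderFourCommutator

/-!
# ω-census, family (b3): conjecture C9 (b) HOLDS for every finite group of class `≤ 2` whose derived group has order dividing `4`

HONEST FRAMING (pub-omega census; verbatim): lottery ticket; floor = certified bounds/negative ranges.
Census BOOKKEEPING (conjecture C9 of the cell, STRUCTURE.md §2; pub-omega kernel-l4 gen 15, task K-4).  Assembly of the three class-`2`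
uniform theorems of the night (`BoxBadDerivedTwo`: `|G′| ≤ 2`; `BoxBadDerivedFour`: commutators in a central four-group;
`BoxBadOrderFourCommutator`: a central commutator of order `4`) into ONE intrinsic statement:
**`index_center_le_four_of_commutator`**: if `G′ = commutator G` is central and `|G′| ∣ 4`, then `BoxUseful G → [G : Z(G)] ≤ 4`.
This is C9 (b) on that class, and it contains every CLASS-`2` MINIMAL bad `2`-group of every order (a minimal bad `2`-group has `|G′| ≤ 4`:
its quotient by a central involution has centre index `4`), i.e. types I, II-a, II-b of the seat's census (memo K4 §8).  Route: if some
commutator has `c² ≠ 1` it is a central commutator of order `4`; else if two distinct non-trivial commutators exist they span `G′` (four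
distinct central involutions `1, c₁, c₂, c₁c₂` fill a group of order `≤ 4`); else all commutators lie in `{1, c}`.  Nothing here is progress
on `ω`.
-/

namespace Summit.MatrixMultiplication.OmegaCensus

open Finset ProductBoxBound

namespace CommPairs

variable {G : Type*} [Group G]

/-- Every commutator `a b a⁻¹ b⁻¹` lies in the derived group. [folklore] -/
theorem comm_mem_commutator (a b : G) : a * b * a⁻¹ * b⁻¹ ∈ commutator G := by
  rw [← commutatorElement_def]
  exact Subgroup.commutator_mem_commutator (Subgroup.mem_top a) (Subgroup.mem_top b)

/-- **C9 (b) for class `≤ 2` with `|G′| ∣ 4`.** If the derived group is central of order dividing `4`, a box-useful finite group has centre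
of index at most `4`. [folklore] -/
theorem index_center_le_four_of_commutator [Fintype G] [DecidableEq G] (hZ : commutator G ≤ Subgroup.center G)
    (h4 : Nat.card (commutator G) ∣ 4) (hG : BoxUseful G) : (Subgroup.center G).index ≤ 4 := by
  classical
  have cen : ∀ a b : G, a * b * a⁻¹ * b⁻¹ ∈ Subgroup.center G := fun a b => hZ (comm_mem_commutator a b)
  have pow4 : ∀ a b : G, (a * b * a⁻¹ * b⁻¹) ^ 4 = 1 := fun a b =>
    orderOf_dvd_iff_pow_eq_one.mp (((commutator G).orderOf_dvd_natCard (comm_mem_commutator a b)).trans h4)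
  -- case 1: a commutator of order `4`
  by_cases hA : ∃ a b : G, (a * b * a⁻¹ * b⁻¹) * (a * b * a⁻¹ * b⁻¹) ≠ 1
  · obtain ⟨a, b, hab⟩ := hA
    exact absurd hG (not_boxUseful_of_comm4 (g := a) (h := b) rfl (cen a b) hab (by
      have := pow4 a b; simpa only [pow_succ, pow_zero, one_mul, mul_assoc] using this))
  push Not at hA
  -- case 2: abelian
  by_cases hB : ∀ a b : G, a * b * a⁻¹ * b⁻¹ = 1
  · have htop : Subgroup.center G = ⊤ := by
      rw [Subgroup.eq_top_iff']; intro x; rw [Subgroup.mem_center_iff]; intro g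
      calc g * x = g * x * g⁻¹ * x⁻¹ * (x * g) := by group
        _ = x * g := by rw [hB, one_mul]
    rw [htop, Subgroup.index_top]; omega
  push Not at hB
  obtain ⟨a, b, hab⟩ := hB
  set c₁ := a * b * a⁻¹ * b⁻¹ with hc₁
  -- case 3: all commutators in `{1, c₁}`
  by_cases hC : ∀ a' b' : G, a' * b' * a'⁻¹ * b'⁻¹ = 1 ∨ a' * b' * a'⁻¹ * b'⁻¹ = c₁
  · exact index_center_le_four_of_boxUseful hC hG
  push Not at hC
  obtain ⟨a', b', hne1, hne2⟩ := hC
  set c₂ := a' * b' * a'⁻¹ * b'⁻¹ with hc₂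
  -- case 4: two distinct non-trivial commutators `c₁, c₂`: they fill `G′`
  have h11 : c₁ * c₁ = 1 := hA a b
  have h22 : c₂ * c₂ = 1 := hA a' b'
  have hz1 : c₁ ∈ Subgroup.center G := cen a b
  have hz2 : c₂ ∈ Subgroup.center G := cen a' b'
  have h12 : c₁ ≠ c₂ := fun e => hne2 e.symm
  have h120 : c₁ * c₂ ≠ 1 := by
    intro e; apply h12
    calc c₁ = c₁ * (c₂ * c₂) := by rw [h22, mul_one]
      _ = c₂ := by rw [← mul_assoc, e, one_mul]
  have h121 : c₁ * c₂ ≠ c₁ := by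
    intro e; apply hne1
    calc c₂ = c₁ * (c₁ * c₂) := by rw [← mul_assoc, h11, one_mul]
      _ = 1 := by rw [e, h11]
  have h122 : c₁ * c₂ ≠ c₂ := by
    intro e; apply hab
    calc c₁ = c₁ * c₂ * c₂ := by rw [mul_assoc, h22, mul_one]
      _ = 1 := by rw [e, h22]
  -- the four elements exhaust the derived group
  let S : Finset G := {1, c₁, c₂, c₁ * c₂}
  have hSsub : (↑S : Set G) ⊆ (commutator G : Set G) := by
    intro x hx
    rw [Finset.mem_coe] at hx
    simp only [S, Finset.mem_insert, Finset.mem_singleton] at hx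
    rw [SetLike.mem_coe]
    rcases hx with hx | hx | hx | hx <;> rw [hx]
    · exact (commutator G).one_mem
    · exact comm_mem_commutator a b
    · exact comm_mem_commutator a' b'
    · exact (commutator G).mul_mem (comm_mem_commutator a b) (comm_mem_commutator a' b')
  have hScard : S.card = 4 := by
    rw [Finset.card_insert_of_notMem (by simp [hab.symm, hne1.symm, h120.symm]),
      Finset.card_insert_of_notMem (by simp [h12, h121.symm]), Finset.card_insert_of_notMem (by simpa using h122.symm),
      Finset.card_singleton]
  have hDle : Nat.card (commutator G) ≤ 4 := Nat.le_of_dvd (by norm_num) h4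
  have hSeq : (↑S : Set G) = (commutator G : Set G) := by
    apply Set.eq_of_subset_of_ncard_le hSsub
    rw [Set.ncard_coe_finset, hScard, ← Nat.card_coe_set_eq]
    exact hDle
  have hcomm : ∀ x y : G, x * y * x⁻¹ * y⁻¹ = 1 ∨ x * y * x⁻¹ * y⁻¹ = c₁ ∨ x * y * x⁻¹ * y⁻¹ = c₂ ∨
      x * y * x⁻¹ * y⁻¹ = c₁ * c₂ := by
    intro x y
    have hx : x * y * x⁻¹ * y⁻¹ ∈ (commutator G : Set G) := comm_mem_commutator x y
    rw [← hSeq] at hx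
    simpa [S] using hx
  exact absurd hG (not_boxUseful_of_comm_four hcomm hz1 hz2 h11 h22 h12 hab hne1 rfl rfl)

end CommPairs

end Summit.MatrixMultiplication.OmegaCensus
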